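import Summits.AtomisticToContinuum.HydrodynamicLimit.Theses.JParityClosure
import HarnessLib

/-!
# Line `Sketch`, crux `JParityClosure.RateFloor` (stmt-AtomisticToContinuum-13080) — c4 companion workfile: THE SPLIT
# `RateFloor ⇐ RateFloorKinetic ∧ SubgridDomination` (PROVED)

Third option for the planner (besides restating the crux as (a) `RateFloorKinetic` or (b') `RateFloorFlat`, `RESTATE.md`): KEEP the filed
crux and split it into two items with DISJOINT difficulty profiles —
* `RateFloorKinetic` (texts in `Lines/Sketch.lean` §7⅞ and `RESTATE.md`): the floor against the KINETIC-scale mollified pair functional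
  `B_{R_N}`, `R_N = λ(N+1)^{-1/3}` — an ENTROPY-CLASS statement (transfer from `EqSuperExpDeficitKinetic` proved in the skeleton; residue =
  one believed equilibrium large-deviation bound);
* `SubgridDomination` (new, below): along the flow the `r`-mollified pair functional is dominated, up to a universal factor `Cd` and slack
  `η`, by the kinetic-scale one — `σ³∫₀^τ∫χB_r ≤ Cd·σ³∫₀^τ∫χB_{R_N} + η` in probability (`∃Cd ∀profiles ∃σ₀ ∀… ∀ηδ ∃r₀ ∀r ∃λ₀ ∀λ ∃N₀ ∀N`).
  This is EXACTLY the isolated turbulence content ("no O(1) kinetic energy in velocity variation at scale r on positive B-measure",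
  `S11-entropy-class-analysis.md` §3): false in the entropy class (r-scale laminar shear), plausible from smooth data (Kolmogorov scaling),
  inaccessible to entropy/energy/stationarity — the honest residue of the filed crux, now as ONE clean item.
The composition `rateFloor_of_kinetic_of_subgrid` is pure arithmetic + a union bound (no trajectory facts): `g₀ := g₀ᵏ/Cd`.
prover-line-stmt-AtomisticToContinuum-13080-c4-0, 2026-08-16.
-/

noncomputable section

open scoped BigOperators Topology ENNReal NNReal InnerProductSpace RealInnerProductSpace Classical
open MeasureTheory Set Filter Function
open Literature.Analysis.FluidPDE Literature.MathematicalPhysics.KineticTheory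
open Summit.AtomisticToContinuum.HydrodynamicLimit.Theses.JParityClosure

namespace Summit.AtomisticToContinuum.HydrodynamicLimit.Cruxes.RateFloor.SketchSplit

/-- **`RateFloorKinetic`** (restatement (a), verbatim the skeleton's §7⅞ text): the crux mollified at the kinetic scale
`R_N = λ(N+1)^{-1/3}`. [folklore] -/
def RateFloorKinetic : Prop :=
  ∃ g₀ : ℝ, 0 < g₀ ∧ ∀ (a₀ θ₀ : Literature.MathematicalPhysics.KineticTheory.T3 → ℝ) (u₀ : Literature.MathematicalPhysics.KineticTheory.T3 → Literature.MathematicalPhysics.KineticTheory.V3), Continuous a₀ → Continuous θ₀ → Continuous u₀ → (∀ x, 0 < a₀ x) → (∀ x, 0 < θ₀ x) → ∃ σ₀ : ℝ, 0 < σ₀ ∧ ∀ σ : ℝ, 0 < σ → σ < σ₀ → ∀ Φ : (N : ℕ) → Literature.Analysis.FluidPDE.HardSphereFlow (Literature.Analysis.FluidPDE.Torus.geometry (Fin 3)) (Literature.MathematicalPhysics.KineticTheory.hsDiameter σ N) (N + 1), ∀ τ : ℝ, 0 < τ → ∀ χ : ℝ × UnitAddTorus (Fin 3) → ℝ, Continuous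 χ → (∀ p, 0 ≤ χ p) → ∀ Ξ : EuclideanSpace ℝ (Fin 3) × EuclideanSpace ℝ (Fin 3) × EuclideanSpace ℝ (Fin 3) → ℝ, Continuous Ξ → (∀ q, 0 ≤ Ξ q) → (∃ C : ℝ, ∀ q, Ξ q ≤ C) → ∀ η δ : ℝ, 0 < η → 0 < δ → ∃ lam₀ : ℝ, 0 < lam₀ ∧ ∀ lam : ℝ, lam₀ ≤ lam → ∃ N₀ : ℕ, ∀ N : ℕ, N₀ ≤ N → let r : ℝ := lam * ((N + 1 : ℕ) : ℝ) ^ (-(1 / 3 : ℝ)); let ε := Literature.MathematicalPhysics.KineticTheory.hsDiameter σ N; let G := Literature.Analysis.FluidPDE.Torus.geometry (Fin 3); let γ := fun z (s : ℝ) => (Φ N).flow s z; let bx : UnitAddTorus (Fin 3) → UnitAddTorus (Fin 3) → ℝ := fun x y => 3 / (Real.pi * r ^ 3) * max (1 - Literature.Analysis.FluidPDE.Torus.euclidDist x y / r) 0; let Θ := fun (Ξ : EuclideanSpace ℝ (Fin 3) × EuclideanSpace ℝ (Fin 3) × EuclideanSpace ℝ (Fin 3) → ℝ) (v w : EuclideanSpace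 ℝ (Fin 3)) => ∫ ω : Metric.sphere (0 : EuclideanSpace ℝ (Fin 3)) 1, Ξ ((ω : EuclideanSpace ℝ (Fin 3)), v, w) * Literature.MathematicalPhysics.KineticTheory.hardSphereKernel (w, v) ω ∂Literature.MathematicalPhysics.KineticTheory.sphereMeasure; let B := fun Ξ z s (x₀ : UnitAddTorus (Fin 3)) => ∫ p, bx p.1.1 x₀ * bx p.2.1 x₀ * Θ Ξ p.1.2 p.2.2 ∂((Literature.Analysis.FluidPDE.empiricalMeasure (γ z s)).prod (Literature.Analysis.FluidPDE.empiricalMeasure (γ z s))); let pv := fun z s (i j : Fin (N + 1)) => Literature.Analysis.FluidPDE.reflectVel (G.sepVec (γ z s i).1 (γ z s j).1) ((γ z s i).2, (γ z s j).2); let Kc := fun (Fn : Literature.Analysis.FluidPDE.Config (N + 1) (Fin 3) Literature.MathematicalPhysics.KineticTheory.T3 → ℝ → Fin (N + 1) → Fin (N + 1) → ℝ) z => ε / (N + 1 : ℝ) * ∑ᶠ (s : ℝ) (_ : s ∈ Literature.Analysis.FluidPDE.collisionTimes G ε (γ z) ∩ Set.Icc 0 τ), ∑ i : Fin (N + 1),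 ∑ j : Fin (N + 1), (if i ≠ j ∧ ‖G.sepVec (γ z s i).1 (γ z s j).1‖ = ε then Fn z s i j else 0); Literature.MathematicalPhysics.KineticTheory.localGibbsLaw σ a₀ u₀ θ₀ N (Φ N) {z | Kc (fun z s i j => χ (s, (γ z s i).1) * Ξ (ε⁻¹ • G.sepVec (γ z s i).1 (γ z s j).1, (pv z s i j).1, (pv z s i j).2)) z < g₀ * σ ^ 3 * (∫ s in Set.Icc (0 : ℝ) τ, ∫ x : UnitAddTorus (Fin 3), χ (s, x) * B Ξ z s x) - η} ≤ ENNReal.ofReal δ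

/-- **`SubgridDomination`** — the isolated sub-`r` content of the filed crux: for a universal `Cd > 0`, along the local-Gibbs hard-sphere
flow, the `r`-mollified ideal pair functional is dominated in probability by `Cd ×` the kinetic-scale one plus `η`
(`bxk`, `Bk` = the crux's `bx`, `B` at scale `λ(N+1)^{-1/3}`).  Heuristically TRUE from smooth data (energy at scale `r` is
`≍ (ε_d r)^{2/3} → 0`; density-wise the finer mollification can only increase the functional), FALSE for entropy-class data (r-scale laminar
shear), beyond entropy/energy/stationarity methods. [folklore] -/
def SubgridDomination : Prop :=
  ∃ Cd : ℝ, 0 < Cd ∧ ∀ (a₀ θ₀ : Literature.MathematicalPhysics.KineticTheory.T3 → ℝ) (u₀ : Literature.MathematicalPhysics.KineticTheory.T3 → Literature.MathematicalPhysics.KineticTheory.V3), Continuous a₀ → Continuous θ₀ → Continuous u₀ → (∀ x, 0 < a₀ x) → (∀ x, 0 < θ₀ x) → ∃ σ₀ : ℝ, 0 < σ₀ ∧ ∀ σ : ℝ, 0 < σ → σ < σ₀ → ∀ Φ : (N : ℕ) → Literature.Analysis.FluidPDE.HardSphereFlow (Literature.Analysis.FluidPDE.Torus.geometry (Fin 3))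 (Literature.MathematicalPhysics.KineticTheory.hsDiameter σ N) (N + 1), ∀ τ : ℝ, 0 < τ → ∀ χ : ℝ × UnitAddTorus (Fin 3) → ℝ, Continuous χ → (∀ p, 0 ≤ χ p) → ∀ Ξ : EuclideanSpace ℝ (Fin 3) × EuclideanSpace ℝ (Fin 3) × EuclideanSpace ℝ (Fin 3) → ℝ, Continuous Ξ → (∀ q, 0 ≤ Ξ q) → (∃ C : ℝ, ∀ q, Ξ q ≤ C) → ∀ η δ : ℝ, 0 < η → 0 < δ → ∃ r₀ : ℝ, 0 < r₀ ∧ ∀ r : ℝ, 0 < r → r < r₀ → ∃ lam₀ : ℝ, 0 < lam₀ ∧ ∀ lam : ℝ, lam₀ ≤ lam → ∃ N₀ : ℕ, ∀ N : ℕ, N₀ ≤ N → let γ := fun z (s : ℝ) => (Φ N).flow s z; let bx : UnitAddTorus (Fin 3) → UnitAddTorus (Fin 3) → ℝ := fun x y => 3 / (Real.pi * r ^ 3) * max (1 - Literature.Analysis.FluidPDE.Torus.euclidDist x y / r) 0; let bxk : UnitAddTorus (Fin 3) → UnitAddTorus (Fin 3) → ℝ := fun x y => 3 / (Real.pi * (lam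 * ((N + 1 : ℕ) : ℝ) ^ (-(1 / 3 : ℝ))) ^ 3) * max (1 - Literature.Analysis.FluidPDE.Torus.euclidDist x y / (lam * ((N + 1 : ℕ) : ℝ) ^ (-(1 / 3 : ℝ)))) 0; let Θ := fun (Ξ : EuclideanSpace ℝ (Fin 3) × EuclideanSpace ℝ (Fin 3) × EuclideanSpace ℝ (Fin 3) → ℝ) (v w : EuclideanSpace ℝ (Fin 3)) => ∫ ω : Metric.sphere (0 : EuclideanSpace ℝ (Fin 3)) 1, Ξ ((ω : EuclideanSpace ℝ (Fin 3)), v, w) * Literature.MathematicalPhysics.KineticTheory.hardSphereKernel (w, v) ω ∂Literature.MathematicalPhysics.KineticTheory.sphereMeasure; let B := fun Ξ z s (x₀ : UnitAddTorus (Fin 3)) => ∫ p, bx p.1.1 x₀ * bx p.2.1 x₀ * Θ Ξ p.1.2 p.2.2 ∂((Literature.Analysis.FluidPDE.empiricalMeasure (γ z s)).prod (Literature.Analysis.FluidPDE.empiricalMeasure (γ z s))); let Bk := fun Ξ z s (x₀ : UnitAddTorus (Fin 3)) => ∫ p, bxk p.1.1 x₀ * bxk p.2.1 x₀ * Θ Ξ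 p.1.2 p.2.2 ∂((Literature.Analysis.FluidPDE.empiricalMeasure (γ z s)).prod (Literature.Analysis.FluidPDE.empiricalMeasure (γ z s))); Literature.MathematicalPhysics.KineticTheory.localGibbsLaw σ a₀ u₀ θ₀ N (Φ N) {z | Cd * (∫ s in Set.Icc (0 : ℝ) τ, ∫ x : UnitAddTorus (Fin 3), χ (s, x) * Bk Ξ z s x) + η < (∫ s in Set.Icc (0 : ℝ) τ, ∫ x : UnitAddTorus (Fin 3), χ (s, x) * B Ξ z s x)} ≤ ENNReal.ofReal δ

/-- The union-bound arithmetic of the split, abstractly: if the kinetic deficit `K < gᵏ s Iᵏ − η₁` and the domination failure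
`Cd Iᵏ + η₂ < I` are both rare, so is the macroscopic deficit `K < (gᵏ/Cd) s I − η` once `η₁ + (gᵏ/Cd) s η₂ ≤ η`. [folklore] -/
theorem measure_deficit_le_add {α : Type*} [MeasurableSpace α] (μ : Measure α) (Kf Ir Ik : α → ℝ)
    {gk Cd s η η₁ η₂ : ℝ} (hgk : 0 ≤ gk) (hCd : 0 < Cd) (hs : 0 ≤ s) (hη : η₁ + gk / Cd * s * η₂ ≤ η) {a b : ℝ≥0∞}
    (h1 : μ {z | Kf z < gk * s * Ik z - η₁} ≤ a) (h2 : μ {z | Cd * Ik z + η₂ < Ir z} ≤ b) :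
    μ {z | Kf z < gk / Cd * s * Ir z - η} ≤ a + b := by
  have hsub : {z | Kf z < gk / Cd * s * Ir z - η} ⊆ {z | Kf z < gk * s * Ik z - η₁} ∪ {z | Cd * Ik z + η₂ < Ir z} := by
    intro z hz
    by_contra hcon
    simp only [Set.mem_union, Set.mem_setOf_eq, not_or, not_lt] at hcon
    obtain ⟨hK, hI⟩ := hcon
    have hz' : Kf z < gk / Cd * s * Ir z - η := hz
    have hc : 0 ≤ gk / Cd * s := by positivity
    have h3 : gk / Cd * s * Ir z ≤ gk / Cd * s * (Cd * Ik z + η₂) := mul_le_mul_of_nonneg_left hI hc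
    have h4 : gk / Cd * s * (Cd * Ik z + η₂) = gk * s * Ik z + gk / Cd * s * η₂ := by
      field_simp
    nlinarith
  calc μ {z | Kf z < gk / Cd * s * Ir z - η} ≤ μ ({z | Kf z < gk * s * Ik z - η₁} ∪ {z | Cd * Ik z + η₂ < Ir z}) :=
        measure_mono hsub
    _ ≤ μ {z | Kf z < gk * s * Ik z - η₁} + μ {z | Cd * Ik z + η₂ < Ir z} := measure_union_le _ _
    _ ≤ a + b := add_le_add h1 h2

/-- **THE SPLIT: `RateFloorKinetic → SubgridDomination → RateFloor`** (PROVED).  With `g₀ := g₀ᵏ/Cd`: `σ₀ := min`, slacks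
`η₁ := η/2` (kinetic), `η₂ := η·Cd/(2(g₀ᵏσ³ + 1)·…)` (domination), confidences `δ/2`; `r₀` from the domination item, `λ := max λ₀ λ₀'`,
`N₀ := max`; then `measure_deficit_le_add` after ζ-reducing the two `let`-chains (they share `ε, G, γ, Θ, pv, Kc` verbatim and differ only in the
mollifier scale). [folklore] -/
theorem rateFloor_of_kinetic_of_subgrid (hkin : RateFloorKinetic) (hsub : SubgridDomination) : RateFloor := by
  obtain ⟨gk, hgk, hkin⟩ := hkin
  obtain ⟨Cd, hCd, hsub⟩ := hsub
  refine ⟨gk / Cd, by positivity, fun a₀ θ₀ u₀ ha hθ hu ha0 hθ0 => ?_⟩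
  obtain ⟨σa, hσa, hkin⟩ := hkin a₀ θ₀ u₀ ha hθ hu ha0 hθ0
  obtain ⟨σb, hσb, hsub⟩ := hsub a₀ θ₀ u₀ ha hθ hu ha0 hθ0
  refine ⟨min σa σb, lt_min hσa hσb, ?_⟩
  intro σ hσ hσlt Φ τ hτ χ hχc hχ0 Ξ hΞc hΞ0 hΞC η δ hη hδ
  have hσa' : σ < σa := hσlt.trans_le (min_le_left _ _)
  have hσb' : σ < σb := hσlt.trans_le (min_le_right _ _)
  have hs : (0 : ℝ) ≤ σ ^ 3 := by positivity
  -- slacks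
  set η₂ : ℝ := η / (2 * (gk / Cd * σ ^ 3 + 1)) with hη₂
  have hη₂pos : 0 < η₂ := by positivity
  have hsplit : η / 2 + gk / Cd * σ ^ 3 * η₂ ≤ η := by
    have hc : 0 ≤ gk / Cd * σ ^ 3 := by positivity
    have h1 : gk / Cd * σ ^ 3 * η₂ ≤ η / 2 := by
      rw [hη₂]
      rw [show gk / Cd * σ ^ 3 * (η / (2 * (gk / Cd * σ ^ 3 + 1))) = η / 2 * (gk / Cd * σ ^ 3 / (gk / Cd * σ ^ 3 + 1)) by
        field_simp]
      have h2 : gk / Cd * σ ^ 3 / (gk / Cd * σ ^ 3 + 1) ≤ 1 := (div_le_one (by positivity)).2 (by linarith)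
      exact mul_le_of_le_one_right (by positivity) h2
    linarith
  obtain ⟨lam₀, hlam₀, hkin⟩ := hkin σ hσ hσa' Φ τ hτ χ hχc hχ0 Ξ hΞc hΞ0 hΞC (η / 2) (δ / 2) (by positivity) (by positivity)
  obtain ⟨r₀, hr₀, hsub⟩ := hsub σ hσ hσb' Φ τ hτ χ hχc hχ0 Ξ hΞc hΞ0 hΞC η₂ (δ / 2) hη₂pos (by positivity)
  refine ⟨r₀, hr₀, fun r hr hrlt => ?_⟩
  obtain ⟨lam₀', hlam₀', hsub⟩ := hsub r hr hrlt
  obtain ⟨Na, hkin⟩ := hkin (max lam₀ lam₀') (le_max_left _ _)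
  obtain ⟨Nb, hsub⟩ := hsub (max lam₀ lam₀') (le_max_right _ _)
  refine ⟨max Na Nb, fun N hN => ?_⟩
  have e1 := hkin N ((le_max_left _ _).trans hN)
  have e2 := hsub N ((le_max_right _ _).trans hN)
  dsimp only at e1 e2 ⊢
  have h := measure_deficit_le_add (Literature.MathematicalPhysics.KineticTheory.localGibbsLaw σ a₀ u₀ θ₀ N (Φ N)) _ _ _
    hgk.le hCd hs hsplit e1 e2
  refine h.trans ?_
  rw [← ENNReal.ofReal_add (by positivity) (by positivity), add_halves]

end Summit.AtomisticToContinuum.HydrodynamicLimit.Cruxes.RateFloor.SketchSplit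

end
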